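import Summits.RiemannHypothesis.RiemannHypothesis.Theorems.SignConeSignConeOscillatoryStubExtremalExistsL2
import Literature.NumberTheory.LFunctions.WeilDilationVirial
import Mathlib.MeasureTheory.Function.ContinuousMapDense

/-!
# Crux `SignCone.SignConeOscillatory` (stmt-RiemannHypothesis-16302), line `dual_witness` — density in energy, I:
# the unitary dilation of an `L²` window function

Towards `SignConeOscillatory → SignConeExtremalNonneg` (X₂ ⟸ crux, making the KKT split of line `dual_witness`
an EQUIVALENCE): the `L²` extremal `f` of a KKT configuration is only square integrable with finite archimedean
energy, while the crux speaks about smooth tests; the bridge is a DENSITY-IN-ENERGY lemma (smooth tests `gₙ` on the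
window with `gₙ → f` in `L²` AND `reWar (gₙ ⋆ g̃ₙ) → reWar (f ⋆ f̃)`), built in three steps: dilate (this file),
mollify (II), control the log-weighted energy (III).

This file: for `u ∈ L²` supported in `[-a, a]`, Bombieri's unitary dilation
`weilDilate η u (t) = √(1+η) · u((1+η) t)` (`Literature.NumberTheory.LFunctions.weilDilate`, `η > 0`) is `L²`,
supported in `[-a/(1+η), a/(1+η)]`, and `∫ |weilDilate η u - u|² → 0` as `η → 0⁺`
(approximation by continuous compactly supported functions + dominated convergence; the dilation is unitary).
-/

noncomputable section

-- `Summit.RiemannHypothesis.RiemannHypothesis.…` repeats a namespace component by design (D-0017 layout).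
set_option linter.dupNamespace false

open scoped BigOperators ComplexConjugate Topology ENNReal
open MeasureTheory Set Filter Complex

namespace Summit.RiemannHypothesis.RiemannHypothesis.Theorems.SignCone.DualWitness

open Literature.NumberTheory.LFunctions

variable {a : ℝ} {u v : ℝ → ℂ}

/-! ## Algebra of the dilation on functions -/

/-- The dilation is additive-linear: `weilDilate η (u - v) = weilDilate η u - weilDilate η v`. [folklore] -/
theorem weilDilate_sub (η : ℝ) (u v : ℝ → ℂ) :
    weilDilate η (u - v) = weilDilate η u - weilDilate η v := by
  funext t
  simp only [weilDilate, Pi.sub_apply]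
  ring

/-- Support of a dilate: `supp u ⊆ [-a, a]`, `η ≥ 0` ⟹ `supp (weilDilate η u) ⊆ [-a/(1+η), a/(1+η)]`. [folklore] -/
theorem support_weilDilate_subset (hsu : Function.support u ⊆ Icc (-a) a) {η : ℝ} (hη : 0 ≤ η) :
    Function.support (weilDilate η u) ⊆ Icc (-(a / (1 + η))) (a / (1 + η)) := by
  intro t ht
  rw [Function.mem_support, weilDilate_apply] at ht
  have h1 : u ((1 + η) * t) ≠ 0 := fun h => ht (by rw [h, mul_zero])
  have h2 := hsu (Function.mem_support.2 h1)
  have hc : 0 < 1 + η := by linarith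
  constructor
  · rw [neg_le, le_div_iff₀ hc]; nlinarith [h2.1]
  · rw [le_div_iff₀ hc]; nlinarith [h2.2]

/-- In particular `supp (weilDilate η u) ⊆ [-a, a]` for `a ≥ 0`, `η ≥ 0`. [folklore] -/
theorem support_weilDilate_subset' (ha : 0 ≤ a) (hsu : Function.support u ⊆ Icc (-a) a) {η : ℝ} (hη : 0 ≤ η) :
    Function.support (weilDilate η u) ⊆ Icc (-a) a := by
  refine (support_weilDilate_subset hsu hη).trans (Icc_subset_Icc ?_ ?_)
  · have : a / (1 + η) ≤ a := div_le_self ha (by linarith)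
    linarith
  · exact div_le_self ha (by linarith)

/-- Dilates of `L²` functions are `L²` (`η > -1`). [folklore] -/
theorem memLp_weilDilate (hu : MemLp u 2 volume) {η : ℝ} (hη : -1 < η) : MemLp (weilDilate η u) 2 volume := by
  have hc : (1 + η) ≠ 0 := by linarith
  have hmap : MemLp u 2 (Measure.map (fun t : ℝ => (1 + η) * t) volume) := by
    rw [Real.map_volume_mul_left hc]
    exact hu.smul_measure ENNReal.ofReal_ne_top
  have hcomp : MemLp (u ∘ fun t : ℝ => (1 + η) * t) 2 volume :=
    hmap.comp_of_map (measurable_const_mul _).aemeasurable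
  have e : weilDilate η u = fun t => (Real.sqrt (1 + η) : ℂ) * (u ∘ fun t : ℝ => (1 + η) * t) t := by
    funext t; rfl
  rw [e]
  exact hcomp.const_mul _

/-- `MemLp 2` functions have integrable `‖·‖²`. [folklore] -/
theorem integrable_norm_sq_of_memLp (hu : MemLp u 2 volume) : Integrable fun t => ‖u t‖ ^ 2 :=
  (memLp_two_iff_integrable_sq_norm hu.1).1 hu

/-! ## `L²`-continuity of the dilation at `η = 0⁺` -/

/-- **Continuous compactly supported functions**: `∫ |weilDilate η v - v|² → 0` as `η → 0⁺` (dominated convergence: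
the integrand is bounded by `(2 sup|v|)²` on a fixed compact set for `η ∈ (0, 1]` and tends to `0` pointwise). [folklore] -/
theorem tendsto_integral_norm_sq_weilDilate_sub_of_continuous (hv : Continuous v) (hvs : HasCompactSupport v) :
    Tendsto (fun η => ∫ x, ‖weilDilate η v x - v x‖ ^ 2) (𝓝[>] 0) (𝓝 0) := by
  obtain ⟨K, hK⟩ := hv.bounded_above_of_compact_support hvs
  have hK0 : 0 ≤ K := (norm_nonneg _).trans (hK 0)
  obtain ⟨R, hR⟩ := hvs.isCompact.isBounded.subset_closedBall 0
  have hvR : ∀ x, R < |x| → v x = 0 := fun x hx =>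
    image_eq_zero_of_notMem_tsupport fun h => by
      have := hR h
      rw [Metric.mem_closedBall, dist_zero_right, Real.norm_eq_abs] at this
      linarith
  -- pointwise convergence
  have hpt : ∀ x, Tendsto (fun η => ‖weilDilate η v x - v x‖ ^ 2) (𝓝[>] 0) (𝓝 0) := by
    intro x
    have h1 : Tendsto (fun η : ℝ => weilDilate η v x) (𝓝 0) (𝓝 (weilDilate 0 v x)) := by
      simp only [weilDilate_apply]
      refine Tendsto.mul ?_ ?_
      · exact (Complex.continuous_ofReal.tendsto _).comp
          ((Real.continuous_sqrt.tendsto _).comp (tendsto_const_nhds.add tendsto_id))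
      · exact (hv.tendsto _).comp ((tendsto_const_nhds.add tendsto_id).mul tendsto_const_nhds)
    rw [weilDilate_zero] at h1
    have h2 : Tendsto (fun η : ℝ => ‖weilDilate η v x - v x‖ ^ 2) (𝓝 0) (𝓝 (‖v x - v x‖ ^ 2)) :=
      ((h1.sub tendsto_const_nhds).norm).pow 2
    rw [sub_self, norm_zero, zero_pow two_ne_zero] at h2
    exact h2.mono_left nhdsWithin_le_nhds
  -- domination on `η ∈ (0, 1]` by `(2·2K)²` on `[-|R|, |R|]`, `0` outside (for `|x| > |R|` both terms vanish)
  set B : ℝ → ℝ := (Icc (-|R|) |R|).indicator fun _ => (2 * K + K) ^ 2 with hB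
  have hBint : Integrable B := (integrableOn_const measure_Icc_lt_top.ne).integrable_indicator measurableSet_Icc
  have hdom : ∀ᶠ η in 𝓝[>] (0 : ℝ), ∀ᵐ x ∂volume, ‖‖weilDilate η v x - v x‖ ^ 2‖ ≤ B x := by
    have hI : Ioo (0 : ℝ) 1 ∈ 𝓝[>] (0 : ℝ) := Ioo_mem_nhdsGT one_pos
    filter_upwards [hI] with η hη
    refine Eventually.of_forall fun x => ?_
    rw [Real.norm_eq_abs, abs_of_nonneg (by positivity)]
    by_cases hx : x ∈ Icc (-|R|) |R|
    · rw [hB, indicator_of_mem hx]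
      have hsq : Real.sqrt (1 + η) ≤ 2 := by
        rw [Real.sqrt_le_left (by norm_num)]; nlinarith [hη.2]
      have h1 : ‖weilDilate η v x‖ ≤ 2 * K := by
        rw [weilDilate_apply, norm_mul, Complex.norm_real, Real.norm_of_nonneg (Real.sqrt_nonneg _)]
        exact mul_le_mul hsq (hK _) (norm_nonneg _) (by norm_num)
      have h2 : ‖weilDilate η v x - v x‖ ≤ 2 * K + K := (norm_sub_le _ _).trans (add_le_add h1 (hK x))
      exact pow_le_pow_left₀ (norm_nonneg _) h2 2
    · rw [hB, indicator_of_notMem hx]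
      have hx' : |R| < |x| := by
        rw [mem_Icc, not_and_or, not_le, not_le] at hx
        rcases hx with h | h
        · exact lt_of_lt_of_le (by linarith) (neg_le_abs x)
        · exact lt_of_lt_of_le h (le_abs_self x)
      have hR' : R < |x| := lt_of_le_of_lt (le_abs_self R) hx'
      have hc : (1 : ℝ) ≤ 1 + η := by linarith [hη.1]
      have hR'' : R < |(1 + η) * x| := by
        rw [abs_mul, abs_of_pos (by linarith [hη.1])]
        exact lt_of_lt_of_le hR' (le_mul_of_one_le_left (abs_nonneg _) hc)
      rw [weilDilate_apply, hvR x hR', hvR _ hR'', mul_zero, sub_zero, norm_zero, zero_pow two_ne_zero]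
  have hmeas : ∀ᶠ η in 𝓝[>] (0 : ℝ), AEStronglyMeasurable (fun x => ‖weilDilate η v x - v x‖ ^ 2) volume := by
    refine Eventually.of_forall fun η => ?_
    have hc : Continuous (weilDilate η v) :=
      continuous_const.mul (hv.comp (continuous_const.mul continuous_id))
    exact ((hc.sub hv).norm.pow 2).aestronglyMeasurable
  have h := tendsto_integral_filter_of_dominated_convergence B hmeas hdom hBint (Eventually.of_forall hpt)
  simpa only [integral_zero] using h

/-- **`L²`-continuity of the dilation**: for `u ∈ L²`, `∫ |weilDilate η u - u|² → 0` as `η → 0⁺` (approximate `u`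
by a continuous compactly supported `v`; the dilation is unitary, so the two error terms are `∫|u - v|²`). [folklore] -/
theorem tendsto_integral_norm_sq_weilDilate_sub (hu : MemLp u 2 volume) :
    Tendsto (fun η => ∫ x, ‖weilDilate η u x - u x‖ ^ 2) (𝓝[>] 0) (𝓝 0) := by
  rw [tendsto_order]
  refine ⟨fun b hb => Eventually.of_forall fun η => lt_of_lt_of_le hb (integral_nonneg fun _ => by positivity),
    fun ε hε => ?_⟩
  -- a continuous compactly supported `v` with `∫ |u - v|² ≤ ε/9`
  have hu' : MemLp u (ENNReal.ofReal 2) volume := by rw [ENNReal.ofReal_ofNat]; exact hu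
  obtain ⟨v, hvs, hvε, hvc, hv2⟩ :=
    hu'.exists_hasCompactSupport_integral_rpow_sub_le (p := 2) zero_lt_two (ε := ε / 9) (by positivity)
  have hvε' : ∫ x, ‖u x - v x‖ ^ 2 ≤ ε / 9 := by
    have e : (fun x => ‖u x - v x‖ ^ (2 : ℝ)) = fun x => ‖u x - v x‖ ^ 2 := by
      funext x; exact Real.rpow_two _
    rw [← e]
    exact hvε
  have hv2' : MemLp v 2 volume := by rw [← ENNReal.ofReal_ofNat]; exact hv2
  have hvlim := tendsto_integral_norm_sq_weilDilate_sub_of_continuous hvc hvs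
  have hev : ∀ᶠ η in 𝓝[>] (0 : ℝ), ∫ x, ‖weilDilate η v x - v x‖ ^ 2 < ε / 9 :=
    (tendsto_order.1 hvlim).2 _ (by positivity)
  have hpos : ∀ᶠ η in 𝓝[>] (0 : ℝ), (0 : ℝ) < η := self_mem_nhdsWithin
  filter_upwards [hev, hpos] with η hη hη0
  have hη1 : -1 < η := by linarith
  -- the three pieces and their integrability
  have hA : Integrable fun x => ‖weilDilate η u x - weilDilate η v x‖ ^ 2 := by
    have := integrable_norm_sq_of_memLp (memLp_weilDilate (hu.sub hv2') hη1)
    refine this.congr (Eventually.of_forall fun x => ?_)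
    simp only [weilDilate_sub, Pi.sub_apply]
  have hBi : Integrable fun x => ‖weilDilate η v x - v x‖ ^ 2 :=
    integrable_norm_sq_of_memLp ((memLp_weilDilate hv2' hη1).sub hv2')
  have hC : Integrable fun x => ‖v x - u x‖ ^ 2 := integrable_norm_sq_of_memLp (hv2'.sub hu)
  have hAval : ∫ x, ‖weilDilate η u x - weilDilate η v x‖ ^ 2 = ∫ x, ‖u x - v x‖ ^ 2 := by
    have e : (fun x => ‖weilDilate η u x - weilDilate η v x‖ ^ 2) = fun x => ‖weilDilate η (u - v) x‖ ^ 2 := by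
      funext x; rw [weilDilate_sub]; rfl
    rw [e, integral_norm_sq_weilDilate _ hη1]
    rfl
  have hCval : ∫ x, ‖v x - u x‖ ^ 2 = ∫ x, ‖u x - v x‖ ^ 2 := by
    congr 1; funext x; rw [norm_sub_rev]
  have hpt : ∀ x, ‖weilDilate η u x - u x‖ ^ 2 ≤
      3 * (‖weilDilate η u x - weilDilate η v x‖ ^ 2 + ‖weilDilate η v x - v x‖ ^ 2 + ‖v x - u x‖ ^ 2) := by
    intro x
    have e : weilDilate η u x - u x =
        (weilDilate η u x - weilDilate η v x) + (weilDilate η v x - v x) + (v x - u x) := by ring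
    rw [e]
    -- `‖x + y + z‖² ≤ 3 (‖x‖² + ‖y‖² + ‖z‖²)` (the tree's `FriedlanderIwaniecPrimes.norm_add_three_sq_le`, inlined to keep
    -- the imports light)
    set X := weilDilate η u x - weilDilate η v x
    set Y := weilDilate η v x - v x
    set Z := v x - u x
    have h1 : ‖X + Y + Z‖ ≤ ‖X‖ + ‖Y‖ + ‖Z‖ := (norm_add_le _ _).trans (add_le_add (norm_add_le X Y) le_rfl)
    have h0 : 0 ≤ ‖X + Y + Z‖ := norm_nonneg _
    nlinarith [sq_nonneg (‖X‖ - ‖Y‖), sq_nonneg (‖Y‖ - ‖Z‖), sq_nonneg (‖X‖ - ‖Z‖), norm_nonneg X, norm_nonneg Y,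
      norm_nonneg Z]
  have hInt : Integrable fun x => ‖weilDilate η u x - u x‖ ^ 2 :=
    integrable_norm_sq_of_memLp ((memLp_weilDilate hu hη1).sub hu)
  calc ∫ x, ‖weilDilate η u x - u x‖ ^ 2
      ≤ ∫ x, 3 * (‖weilDilate η u x - weilDilate η v x‖ ^ 2 + ‖weilDilate η v x - v x‖ ^ 2 + ‖v x - u x‖ ^ 2) :=
        integral_mono hInt (((hA.add hBi).add hC).const_mul 3) hpt
    _ = 3 * ((∫ x, ‖weilDilate η u x - weilDilate η v x‖ ^ 2) + (∫ x, ‖weilDilate η v x - v x‖ ^ 2) +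
          ∫ x, ‖v x - u x‖ ^ 2) := by
        have hAB : Integrable fun x => ‖weilDilate η u x - weilDilate η v x‖ ^ 2 + ‖weilDilate η v x - v x‖ ^ 2 :=
          hA.add hBi
        rw [integral_const_mul, integral_add hAB hC, integral_add hA hBi]
    _ < ε := by rw [hAval, hCval]; linarith

/-- Anchor of this file on the crux item (registered sub-goal): `L²`-continuity of the dilation (`∀`-form of
`tendsto_integral_norm_sq_weilDilate_sub`). [folklore] -/
theorem density_dilation_tendsto : ∀ {u : ℝ → ℂ}, MemLp u 2 volume → Tendsto (fun η => ∫ x, ‖weilDilate η u x - u x‖ ^ 2) (𝓝[>] 0) (𝓝 0) :=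
  fun hu => tendsto_integral_norm_sq_weilDilate_sub hu

end Summit.RiemannHypothesis.RiemannHypothesis.Theorems.SignCone.DualWitness

end
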